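import Literature.NumberTheory.EllipticCurves.IwasawaCoinvariantsRankProofs
import HarnessLib

/-!
# Route C `PrintCf2RubinValueTwo`, crux `RestrictedMainConjWithValueAtTwo` (stmt-BirchSwinnertonDyer-23722), brick (RES)(b2), first input of the
# local-defect plan (`RES-LOCAL-DEFECT-cf2c-w8.md` (G)): **a continuous 1-cocycle with values in a `p`-PRIMARY discrete module is a coboundary as
# soon as it vanishes on a normal subgroup of finite index PRIME TO `p`** — the averaging argument behind
# `H¹(G, M) = 0` for `G` (pro-)prime-to-`p` and `M` `p`-primary (the vanishing of the «unramified ⟹ locally trivial» defect at a place `w ∤ 2`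
# of the line `K*_∞` that does not split completely)

Cell `bsd-print-cf2`, width seat `bsd-line-cf2c-w8` g0 (prover-bsd-line-cf2c-w8-g0-0); `--supports stmt-BirchSwinnertonDyer-23722`. HONEST FRAMING: a
generic group-cohomology lemma; nothing here closes the crux or the registered stub; BSD is not proved by any of this; no summit statement is proved by
this seat. No definition, no named fact, no `sorry`. Any topological group `G`, any discrete `G`-module `M`.
* `apply_mul_of_mem_eq`, `apply_eq_apply_out` — a cocycle vanishing on a normal `U` is constant on `U`-cosets (`c(g u) = c(g)`).
* **`oneCocycleClass_eq_zero_of_index_coprime`** — `U ◁ G` of finite index `n` with `p ∤ n`, `c|_U = 0`, `M` `p`-primary ⟹ `[c] = 0`: with `S := Σ_{q ∈ G/U} c(q̃)` one has `g • S = S − n • c(g)` (cocycle identity + reindexing the cosets by `q ↦ g q`), and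
  `a n + b p^K = 1` (`p^K` killing the finitely many values `c(q̃)`) gives `c(g) = g • (−a • S) − (−a • S)`.
Use (next seat): `G := ker κ₂ ⊓ decomp w` modulo inertia at a place `w ∤ 2` of the line (`Frob_w` of infinite order in `Γ_K/ker κ₂ ≅ ℤ₂`, so every open
normal subgroup containing inertia has odd index), `M = W*`: the defect `H¹((ker κ₂ ⊓ D_w)/I_w, (W*)^{I_w})` vanishes.
presearch: Serre, *Galois Cohomology* I §2.2, §2.4 (cor ∘ res = n; `H^q(G, A)` killed by `|G|`), Neukirch–Schmidt–Wingberg (1.6.1) — held; no new fact.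

References: [SerreGaloisCohomology1997] I §2.2–2.4, §5.1; [NeukirchSchmidtWingberg2008] (1.6.1); [Rubin2000] App. B §2.
-/

noncomputable section

open scoped Classical

-- the summit namespace `Summit.BirchSwinnertonDyer.BirchSwinnertonDyer` repeats the problem name by design (D-0017)
set_option linter.dupNamespace false
set_option autoImplicit false

open Literature.NumberTheory.EllipticCurves Literature.NumberTheory.GaloisRepresentations

universe u

namespace Summit.BirchSwinnertonDyer.BirchSwinnertonDyer.Theorems.PrintCf2.LinePush

variable {G : Type u} [Group G] [TopologicalSpace G] [IsTopologicalGroup G]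
  {M : Type u} [AddCommGroup M] [DistribMulAction G M] [TopologicalSpace M] [DiscreteTopology M]

omit [IsTopologicalGroup G] in
/-- A cocycle vanishing on `U` is constant on left `U`-cosets: `c(g u) = c(g)`. [cite: SerreGaloisCohomology1997, I §5.1] -/
theorem apply_mul_of_mem_eq (c : contOneCocycles (discreteTopRep G M)) {U : Subgroup G} (hcU : ∀ u ∈ U, c.1 u = 0) (g : G) {u : G}
    (hu : u ∈ U) : c.1 (g * u) = c.1 g := by
  rw [c.2 g u, hcU u hu]
  change c.1 g + g • (0 : M) = c.1 g
  rw [smul_zero, add_zero]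

omit [IsTopologicalGroup G] in
/-- A cocycle vanishing on the normal subgroup `U` depends only on the coset: `c(g) = c((gU).out)`. [cite: SerreGaloisCohomology1997, I §5.1] -/
theorem apply_eq_apply_out (c : contOneCocycles (discreteTopRep G M)) {U : Subgroup G} [U.Normal] (hcU : ∀ u ∈ U, c.1 u = 0) (g : G) :
    c.1 g = c.1 ((QuotientGroup.mk g : G ⧸ U).out) := by
  have h : ((QuotientGroup.mk g : G ⧸ U).out)⁻¹ * g ∈ U := by
    rw [← QuotientGroup.eq, QuotientGroup.out_eq']
  have e : g = (QuotientGroup.mk g : G ⧸ U).out * (((QuotientGroup.mk g : G ⧸ U).out)⁻¹ * g) := by rw [mul_inv_cancel_left]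
  conv_lhs => rw [e]
  exact apply_mul_of_mem_eq c hcU _ h

/-- **A `p`-primary-valued cocycle vanishing on a normal subgroup of finite index prime to `p` is a coboundary** (the averaging argument:
`H¹(G/U, ·)` is killed by `[G:U]` and the values by a power of `p`). For a continuous 1-cocycle `c : G → M` into a discrete `p`-primary `M` and
a normal subgroup `U` of finite index `n` coprime to `p` with `c|_U = 0`: `[c] = 0` in `H¹(G, M)`. With `S := Σ_{q ∈ G/U} c(q̃)` (`c` is
constant on cosets): `g • S = S − n • c(g)`, and `a n + b p^K = 1` gives `c = ∂(−a • S)`. (No invariance of the values under `U` is needed.)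
[cite: SerreGaloisCohomology1997, I §2.4 (Cor. to Prop. 9: `cor ∘ res = n`)] [cite: NeukirchSchmidtWingberg2008, (1.6.1)] -/
theorem oneCocycleClass_eq_zero_of_index_coprime (p : ℕ) [Fact p.Prime] (hprim : ∀ m : M, ∃ k : ℕ, p ^ k • m = 0)
    (c : contOneCocycles (discreteTopRep G M)) (U : Subgroup G) [U.Normal] [U.FiniteIndex] (hn : U.index.Coprime p)
    (hcU : ∀ u ∈ U, c.1 u = 0) : oneCocycleClass (discreteTopRep G M) c = 0 := by
  haveI : Fintype (G ⧸ U) := Subgroup.fintypeQuotientOfFiniteIndex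
  have hn_card : Fintype.card (G ⧸ U) = U.index := by rw [Subgroup.index_eq_card, Nat.card_eq_fintype_card]
  -- the average
  set S : M := ∑ q : G ⧸ U, c.1 q.out with hS
  -- reindexing: `Σ_q c(g q̃) = S`
  have hreindex : ∀ g : G, ∑ q : G ⧸ U, c.1 (g * q.out) = S := by
    intro g
    have hterm : ∀ q : G ⧸ U, c.1 (g * q.out) = c.1 ((g • q : G ⧸ U).out) := by
      intro q
      rw [apply_eq_apply_out c hcU (g * q.out), ← smul_eq_mul, MulAction.Quotient.mk_smul_out]
    simp_rw [hterm]
    exact Fintype.sum_equiv (MulAction.toPerm g) _ _ fun q ↦ rfl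
  -- `g • S = S − n • c(g)`
  have hkey : ∀ g : G, g • S + U.index • c.1 g = S := by
    intro g
    have h1 : g • S = ∑ q : G ⧸ U, (c.1 (g * q.out) - c.1 g) := by
      rw [hS, Finset.smul_sum]
      refine Finset.sum_congr rfl fun q _ ↦ ?_
      rw [c.2 g q.out]
      change g • c.1 q.out = c.1 g + g • c.1 q.out - c.1 g
      rw [add_sub_cancel_left]
    rw [h1, Finset.sum_sub_distrib, hreindex, Finset.sum_const, Finset.card_univ, hn_card, sub_add_cancel]
  -- a uniform power of `p` killing the values `c(q̃)`, hence all values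
  choose kq hkq using fun q : G ⧸ U ↦ hprim (c.1 q.out)
  set K : ℕ := ∑ q : G ⧸ U, kq q with hK
  have hkill : ∀ g : G, p ^ K • c.1 g = 0 := by
    intro g
    rw [apply_eq_apply_out c hcU g]
    set q : G ⧸ U := QuotientGroup.mk g
    have hle : kq q ≤ K := Finset.single_le_sum (f := kq) (fun _ _ ↦ Nat.zero_le _) (Finset.mem_univ q)
    obtain ⟨d, hd⟩ := Nat.exists_eq_add_of_le hle
    rw [hd, pow_add, mul_comm, mul_smul, hkq q, smul_zero]
  -- Bézout: `a n + b p^K = 1`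
  have hcop : IsCoprime (U.index : ℤ) ((p : ℤ) ^ K) := by
    rw [← Nat.cast_pow, Nat.isCoprime_iff_coprime]
    exact Nat.Coprime.pow_right K hn
  obtain ⟨a, b, hab⟩ := hcop
  -- `c = ∂(−a • S)`
  rw [oneCocycleClass_eq_zero_iff]
  refine ⟨-(a • S), fun g ↦ ?_⟩
  change c.1 g = g • (-(a • S)) - -(a • S)
  have hng : (U.index : ℤ) • c.1 g = S - g • S := by
    rw [natCast_zsmul, eq_sub_iff_add_eq, add_comm, hkey g]
  have hpg : ((p : ℤ) ^ K) • c.1 g = 0 := by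
    rw [← Nat.cast_pow, natCast_zsmul, hkill g]
  calc c.1 g = (a * (U.index : ℤ) + b * (p : ℤ) ^ K) • c.1 g := by rw [hab, one_zsmul]
    _ = a • ((U.index : ℤ) • c.1 g) + b • (((p : ℤ) ^ K) • c.1 g) := by rw [add_zsmul, mul_zsmul, mul_zsmul]
    _ = a • (S - g • S) := by rw [hng, hpg, zsmul_zero, add_zero]
    _ = g • (-(a • S)) - -(a • S) := by rw [zsmul_sub, smul_neg, smul_comm g a S]; abel

end Summit.BirchSwinnertonDyer.BirchSwinnertonDyer.Theorems.PrintCf2.LinePush
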